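import Summits.HodgeConjecture.HodgeConjecture.Theorems.F0P3cStCharTSStLabels          -- ★ B1 milieu: N1→N2→N3 holds (`U3PrincipalSeriesLengthLeTwo`), `continuous_stFst`
import Summits.HodgeConjecture.HodgeConjecture.Theorems.F0P3cStCharTSStJH              -- ★ ST-JH `surjective_of_pin`; ★ TorusCompactPart `valued_apply_eq_one_of_mem_normOneUnits`
import Summits.HodgeConjecture.HodgeConjecture.Theorems.F0P3XiUnramNonsplitInstance     -- ★ `isAdmissible_cmPrincipalSeries`
import Literature.NumberTheory.Automorphic.ConstituentPairFixedRank                     -- ★ p853005 JH-PAIR-RANKS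
import Literature.NumberTheory.Automorphic.SmoothInductionSphericalLine                  -- ★ `finrank_fixedPoints_smoothIndRep_eq` (one-coset Mackey)
import Literature.NumberTheory.Automorphic.CMPrincipalSeriesSpherical                    -- ★ Iwasawa line at `K_v`, `v_torusEntry_eq_one…`, `halfModulusChar_eq_one…`
import HarnessLib

/-!
# F0 · P3c · line LH6 «StCharTS» — (G6)-ST «ST-PARAHORIC-FIXED» @ `K_v`: `St_G(ψ)` has NO `K_v`-spherical vector (RIDER 2b «EP-PAIRS», census EP-PAIRS v1 §3 (4))

Cell `pub/hodgecm-mathlib` (D-0151), FLOOR 0, crux item H413 = `stmt-HodgeConjecture-24833` (`--supports` lane, helper; seat F0P3a-p06 (g25)).  THEOREMS ONLY (no `def` ∕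
instance ∕ notation ∕ named fact ∕ `sorry`); the ST-PIN letters (`ι`, `detZ`, `stG`, `detG` and their clauses, ★ `F0P3cStCharTSStPin.exists_stDetFields`) are READ as
binders.  HONEST LABEL: count-neutral (a RIDER 2b input — the `St_G(ψ)` instance of the parahoric-fixed ranks in `Tr σ(f_EP^G) = dim σ^{K₀} + dim σ^{K₁} − dim σ^{I}`;
closes no node); HC_CM is proved only modulo the 7 printed citations (hLiu418 = stmt-HodgeConjecture-24832, h413 = stmt-HodgeConjecture-24833) until rung 0 closes.

MATHEMATICS [Rogawski1990 §12.2 (1): `JH(i_G(χ_St(ψ))) = {St_G(ψ), ψ∘det_G}`; Borel 1976 §3–§4; Casselman 1995 §2.1, §3].  `V ↦ V^K` is exact, so on the length-two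
`i_G(χ_St(ψ₀))` (★ `U3PrincipalSeriesLengthLeTwo`, in house) the ranks of the two constituents add (★ JH-PAIR-RANKS p853005): §1 **H1** `dim St^K = dim i_G(χ_St(ψ₀))^K −
[χdet ≡ 1 on K]` for every compact open `K`; §2 **H2** on a level containing the `d(1,b,1)`, `b ∈ E¹_v`, `ψ∘det_Z ≡ 1` iff `ψ = 1` (`ι` onto `Z(G)`, ★ ST-JH); §3 **H3@`K_v`**
`dim i_G(χ_St(ψ₀))^{K_v} = [ψ₀ = 1]` (Iwasawa line ∕ one-coset Mackey with `χ_St(ψ₀)(d(1,b,1)) = ψ₀(b)`); the HEAD `St_G(ψ)^{K_v} = ⊥` is the sequel file `F0P3cStCharTSStNoSpherical`.  The `I`∕`K₁` twins (`dim St^{I} = [ψ = 1]`, `St^{K₁} = ⊥`) take the Bruhat–Iwahori decomposition as Mackey binders (ED. 2 at ★ BRUHAT–IWAHORI).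
* §0 `glDiagonal_one_one_mem`, `exists_torus_diag_one_one`, `cmTorusCharPair_diag_one_one` · §1 `finrank_fixedPoints_ofChar`, **`finrank_fixedPoints_st_eq_sub`** ·
  §2 **`comp_detZ_eq_one_on_iff`** · §3 `…_integralLevel_eq_zero`, **`finrank_fixedPoints_cmPrincipalSeries_stChar_integralLevel`**

## References
* [Rogawski1990] J. D. Rogawski, *Automorphic Representations of Unitary Groups in Three Variables*, Ann. of Math. Stud. 123 (1990), §12.2 (1) pp. 172–173, §4.5 p. 45, §4.9 p. 54, §12.6 p. 188.
* [Borel1976] A. Borel, *Admissible representations of a semi-simple group over a local field with vectors fixed under an Iwahori subgroup*, Invent. Math. 35 (1976), §3–§4.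
* [Casselman1995] W. Casselman, *Introduction to the theory of admissible representations of 𝔭-adic reductive groups* (notes, 1995), §2.1, §3.
* [CartierCorvallis1979] P. Cartier, *Representations of 𝔭-adic groups: a survey*, Proc. Symp. Pure Math. 33.1 (1979), §III.3, §IV.1.
* [PlatonovRapinchuk1994] V. Platonov, A. Rapinchuk, *Algebraic Groups and Number Theory* (1994), §5.1.  [BernsteinZelevinsky1976] §2.1–2.3.
-/


set_option autoImplicit false
-- the mandated namespace has the single-problem summit's repeated segment (`HodgeConjecture.HodgeConjecture`)
set_option linter.dupNamespace false

noncomputable section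

open NumberField IsDedekindDomain MeasureTheory
open scoped Matrix MatrixGroups NNReal
open Literature.NumberTheory.Automorphic Literature.NumberTheory.Automorphic.UnitaryGroup
open Literature.NumberTheory.Rogawski1990

namespace Summit.HodgeConjecture.HodgeConjecture.Cruxes.H413.F0P3cStCharTSStParahoricFixed

open Summit.HodgeConjecture.HodgeConjecture.Cruxes.H413
open Summit.HodgeConjecture.HodgeConjecture.Cruxes.H413.F0P3XiPacketFamilyOfRecord (isAdmissible_of_isConstituentOf)

variable (L : Type) [Field L] [NumberField L] [IsCMField L] (v : HeightOneSpectrum (𝓞 ↥(maximalRealSubfield L)))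

/-! ## §0 The torus elements `d(1, b, 1)`, `b ∈ E¹_v`: in `T`, in `B`, in `K_v`; `χ_St(ψ₀)(d(1,b,1)) = ψ₀(b)` -/

/-- `diag(1, b, 1) ∈ U(Φ₃)(L⁺_v)` for `b ∈ E¹_v` (the torus relation `σ(d_{rev i}) d_i = 1`: `σ(1)·1 = 1`, `σ(b) b = 1`). [cite: Rogawski1990, §1.10 p. 9; §12.1 p. 171] -/
theorem glDiagonal_one_one_mem (b : ↥(normOneUnits (conjLocal L (IsCMField.complexConj L) v))) :
    glDiagonal 3 (LocalRing L v) ![(1 : (LocalRing L v)ˣ), (b : (LocalRing L v)ˣ), 1] ∈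
      unitaryGroupOfForm (conjLocal L (IsCMField.complexConj L) v) (cmLocalForm L 3 v) := by
  rw [cmLocalForm_eq_over L 3 v, glDiagonal_mem_unitaryGroupOfForm_antidiagonal_iff]
  have hb := (mem_normOneUnits_iff (b : (LocalRing L v)ˣ)).1 b.2
  intro i
  fin_cases i
  · show conjLocal L (IsCMField.complexConj L) v ((![(1 : (LocalRing L v)ˣ), (b : (LocalRing L v)ˣ), 1] (Fin.rev 0) : (LocalRing L v)ˣ) : LocalRing L v) *
        ((![(1 : (LocalRing L v)ˣ), (b : (LocalRing L v)ˣ), 1] 0 : (LocalRing L v)ˣ) : LocalRing L v) = 1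
    simp
  · show conjLocal L (IsCMField.complexConj L) v ((![(1 : (LocalRing L v)ˣ), (b : (LocalRing L v)ˣ), 1] (Fin.rev 1) : (LocalRing L v)ˣ) : LocalRing L v) *
        ((![(1 : (LocalRing L v)ˣ), (b : (LocalRing L v)ˣ), 1] 1 : (LocalRing L v)ˣ) : LocalRing L v) = 1
    simpa using hb
  · show conjLocal L (IsCMField.complexConj L) v ((![(1 : (LocalRing L v)ˣ), (b : (LocalRing L v)ˣ), 1] (Fin.rev 2) : (LocalRing L v)ˣ) : LocalRing L v) *
        ((![(1 : (LocalRing L v)ˣ), (b : (LocalRing L v)ˣ), 1] 2 : (LocalRing L v)ˣ) : LocalRing L v) = 1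
    simp

/-- **The element `d(1, b, 1)`** (`b ∈ E¹_v`, non-split `v`): a torus element `t` with matrix `diag(1, b, 1)` lying in the hyperspecial level `K_v = U(Φ₃)(𝒪_v)`
(`E¹_v ≤ 𝒪_vˣ`, ★ `valued_apply_eq_one_of_mem_normOneUnits`). [cite: Rogawski1990, §1.10 p. 9; §12.1 p. 171] [cite: PlatonovRapinchuk1994, §5.1] -/
theorem exists_torus_diag_one_one (hns : ∀ w : PlacesOver L v, IsCMField.complexConj L • w.1 = w.1)
    (b : ↥(normOneUnits (conjLocal L (IsCMField.complexConj L) v))) :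
    ∃ t : ↥(torusU (conjLocal L (IsCMField.complexConj L) v) (cmLocalForm L 3 v)),
      glDiagonal 3 (LocalRing L v) ![(1 : (LocalRing L v)ˣ), (b : (LocalRing L v)ˣ), 1] =
          ((t : ↥(unitaryGroupOfForm (conjLocal L (IsCMField.complexConj L) v) (cmLocalForm L 3 v))) : GL (Fin 3) (LocalRing L v)) ∧
        (t : ↥(unitaryGroupOfForm (conjLocal L (IsCMField.complexConj L) v) (cmLocalForm L 3 v))) ∈ cmLocalIntegralLevel L 3 (qsForm L) v := by
  set d : Fin 3 → (LocalRing L v)ˣ := ![(1 : (LocalRing L v)ˣ), (b : (LocalRing L v)ˣ), 1] with hd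
  let g : ↥(unitaryGroupOfForm (conjLocal L (IsCMField.complexConj L) v) (cmLocalForm L 3 v)) :=
    ⟨glDiagonal 3 (LocalRing L v) d, glDiagonal_one_one_mem L v b⟩
  have hgT : g ∈ torusU (conjLocal L (IsCMField.complexConj L) v) (cmLocalForm L 3 v) := (mem_torusU_iff g).2 ⟨d, rfl⟩
  refine ⟨⟨g, hgT⟩, rfl, ?_⟩
  -- valuations of the entries of `diag(1,b,1)` and of its inverse `diag(1,b⁻¹,1)` are `≤ 1`
  have hval : ∀ (e : Fin 3 → (LocalRing L v)ˣ), (∀ k, ∀ w : PlacesOver L v, Valued.v (((e k : (LocalRing L v)ˣ) : LocalRing L v) w) = 1) →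
      ∀ (i j : Fin 3) (w : PlacesOver L v), Valued.v (((glDiagonal 3 (LocalRing L v) e : GL (Fin 3) (LocalRing L v)).val i j) w) ≤ 1 := by
    intro e he i j w
    rw [coe_glDiagonal, Matrix.diagonal_apply]
    split_ifs with hij
    · exact (he i w).le
    · rw [Pi.zero_apply, map_zero]; exact zero_le
  have hd1 : ∀ k, ∀ w : PlacesOver L v, Valued.v (((d k : (LocalRing L v)ˣ) : LocalRing L v) w) = 1 := by
    intro k w
    fin_cases k
    · show Valued.v ((((1 : (LocalRing L v)ˣ) : LocalRing L v)) w) = 1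
      rw [Units.val_one, Pi.one_apply, map_one]
    · exact F0P3cStCharTSTorusCompactPart.valued_apply_eq_one_of_mem_normOneUnits L v hns b.2 w
    · show Valued.v ((((1 : (LocalRing L v)ˣ) : LocalRing L v)) w) = 1
      rw [Units.val_one, Pi.one_apply, map_one]
  have hd2 : ∀ k, ∀ w : PlacesOver L v, Valued.v (((d⁻¹ k : (LocalRing L v)ˣ) : LocalRing L v) w) = 1 := by
    intro k w
    rw [Pi.inv_apply]
    fin_cases k
    · show Valued.v ((((1 : (LocalRing L v)ˣ)⁻¹ : (LocalRing L v)ˣ) : LocalRing L v) w) = 1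
      rw [inv_one, Units.val_one, Pi.one_apply, map_one]
    · exact F0P3cStCharTSTorusCompactPart.valued_apply_eq_one_of_mem_normOneUnits L v hns (inv_mem b.2) w
    · show Valued.v ((((1 : (LocalRing L v)ˣ)⁻¹ : (LocalRing L v)ˣ) : LocalRing L v) w) = 1
      rw [inv_one, Units.val_one, Pi.one_apply, map_one]
  refine (mem_cmLocalIntegralLevel_iff_forall_v_le_one L 3 v g).2 ⟨hval d hd1, fun i j w => ?_⟩
  have hinv : ((g⁻¹ : ↥(unitaryGroupOfForm (conjLocal L (IsCMField.complexConj L) v) (cmLocalForm L 3 v))) : GL (Fin 3) (LocalRing L v)) =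
      glDiagonal 3 (LocalRing L v) d⁻¹ := by
    rw [map_inv]; rfl
  rw [hinv]
  exact hval d⁻¹ hd2 i j w

/-- **`χ_St(ψ₀)(d(1, b, 1)) = ψ₀(b)`**: on a torus element with matrix `diag(1, b, 1)` the character pair `(χ₁, ψ₀)` takes the value `χ₁(1)·ψ₀(1·b·1) = ψ₀(b)`
(★ `torusCharPair_apply_of_glDiagonal_eq`). [cite: Rogawski1990, §12.1 p. 171] -/
theorem cmTorusCharPair_diag_one_one (χ₁ : (LocalRing L v)ˣ →* ℂˣ)
    (ψ₀ : ↥(normOneUnits (conjLocal L (IsCMField.complexConj L) v)) →* ℂˣ)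
    (b : ↥(normOneUnits (conjLocal L (IsCMField.complexConj L) v)))
    (t : ↥(torusU (conjLocal L (IsCMField.complexConj L) v) (cmLocalForm L 3 v)))
    (ht : glDiagonal 3 (LocalRing L v) ![(1 : (LocalRing L v)ˣ), (b : (LocalRing L v)ˣ), 1] =
      ((t : ↥(unitaryGroupOfForm (conjLocal L (IsCMField.complexConj L) v) (cmLocalForm L 3 v))) : GL (Fin 3) (LocalRing L v))) :
    cmTorusCharPair L v χ₁ ψ₀ t = ψ₀ b := by
  rw [cmTorusCharPair, torusCharPair_apply_of_glDiagonal_eq _ _ (cmLocalForm_eq_over L 3 v) 0 χ₁ ψ₀ t _ ht]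
  have h0 : (![(1 : (LocalRing L v)ˣ), (b : (LocalRing L v)ˣ), 1] 0) = 1 := rfl
  rw [h0, map_one, one_mul]
  congr 1
  apply Subtype.ext
  show (∏ j : Fin 3, ![(1 : (LocalRing L v)ˣ), (b : (LocalRing L v)ˣ), 1] j) = (b : (LocalRing L v)ˣ)
  rw [Fin.prod_univ_three]
  show (1 : (LocalRing L v)ˣ) * (b : (LocalRing L v)ˣ) * 1 = (b : (LocalRing L v)ˣ)
  rw [one_mul, mul_one]

/-! ## §1 H1 «ST-RANK = PS-RANK − DET-RANK» at every compact open level -/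

/-- Fixed vectors of a one-dimensional character `χ` under `K`: `dim = [χ ≡ 1 on K]` (★ RANK-ADD `finrank_fixedPoints_eq_ite_of_finrank_eq_one` on `𝟙 ⊗ χ`).
[cite: BernsteinZelevinsky1976, §2.1–2.3] [cite: Borel1976, §3–§4] -/
theorem finrank_fixedPoints_ofChar {G : Type} [Group G] [TopologicalSpace G] [IsTopologicalGroup G] (χ : G →* ℂˣ)
    (hopen : IsOpen ((χ.ker : Subgroup G) : Set G)) (K : Subgroup G) [Decidable (∀ k ∈ K, χ k = 1)] :
    Module.finrank ℂ ((SmoothIrrep.ofChar χ hopen).ρ.fixedPoints K) = if (∀ k ∈ K, χ k = 1) then 1 else 0 := by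
  classical
  have hrk : Module.finrank ℂ (((Representation.trivial ℂ G ℂ).twist χ).fixedPoints K) =
      if (∀ g ∈ K, ((Representation.trivial ℂ G ℂ).twist χ) g = 1) then 1 else 0 :=
    Representation.finrank_fixedPoints_eq_ite_of_finrank_eq_one _ (Module.finrank_self ℂ) K
  have hiff : (∀ g ∈ K, ((Representation.trivial ℂ G ℂ).twist χ) g = 1) ↔ ∀ k ∈ K, χ k = 1 := by
    refine forall₂_congr fun g _ => ?_
    constructor
    · intro h
      have h1 := LinearMap.congr_fun h (1 : ℂ)
      rw [Representation.twist_apply, Representation.trivial_apply, Module.End.one_apply, smul_eq_mul, mul_one] at h1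
      exact Units.val_eq_one.1 h1
    · intro h
      apply LinearMap.ext
      intro z
      rw [Representation.twist_apply, Representation.trivial_apply, Module.End.one_apply, h, Units.val_one, one_smul]
  have key : Module.finrank ℂ (((Representation.trivial ℂ G ℂ).twist χ).fixedPoints K) = if (∀ k ∈ K, χ k = 1) then 1 else 0 := by
    rw [hrk]
    by_cases h : ∀ k ∈ K, χ k = 1
    · rw [if_pos h, if_pos (hiff.2 h)]
    · rw [if_neg h, if_neg (fun h' => h (hiff.1 h'))]
  exact key

open Classical in
set_option maxHeartbeats 1600000 in
set_option synthInstance.maxHeartbeats 400000 in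
-- instance-path unification between `Gqs L v` and the literal carrier of ★ `cmPrincipalSeries` (class of ★ ST-JH ∕ ★ StLabels)
/-- **H1 «ST-RANK = PS-RANK − DET-RANK».**  If the constituents of `i_G(χ_St(ψ₀))` are exactly `πSt ≠ π₁` with `π₁ = ⟦χdet⟧` one-dimensional (the ST-PIN clauses,
READ), then for every representative `r` of `πSt` and every compact open `K ≤ G`: `dim r^K = dim i_G(χ_St(ψ₀))^K − [χdet ≡ 1 on K]`
(`i_G(χ_St(ψ₀))` has length two — ★ `U3PrincipalSeriesLengthLeTwo`, in house via ★ N1 → N2 → N3 —, so ★ JH-PAIR-RANKS `finrank_fixedPoints_eq_sub_of_constituents_pair`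
applies; the character's count is §1 `finrank_fixedPoints_ofChar`). [cite: Rogawski1990, §12.2 (1) p. 173] [cite: Borel1976, §3–§4] [cite: Casselman1995, §2.1] -/
theorem finrank_fixedPoints_st_eq_sub (hns : ∀ w : PlacesOver L v, IsCMField.complexConj L • w.1 = w.1)
    (ψ₀ : ↥(normOneUnits (conjLocal L (IsCMField.complexConj L) v)) →* ℂˣ) (hψ₀ : Continuous fun x => ((ψ₀ x : ℂˣ) : ℂ))
    {πSt π₁ : IrrClass (Gqs L v)} (hne : πSt ≠ π₁)
    (hJH : ∀ c : IrrClass (Gqs L v),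
      c.IsConstituentOf (cmPrincipalSeries L 3 v
        (cmTorusCharPair L v (halfModulusChar (LocalRing L v) * halfModulusChar (LocalRing L v))⁻¹ ψ₀)) ↔ (c = πSt ∨ c = π₁))
    (χdet : Gqs L v →* ℂˣ) (hopen : IsOpen ((χdet.ker : Subgroup (Gqs L v)) : Set (Gqs L v)))
    (hπ₁ : π₁ = IrrClass.mk (SmoothIrrep.ofChar χdet hopen))
    (r : SmoothIrrep (Gqs L v)) (hr : IrrClass.mk r = πSt)
    (K : Subgroup (Gqs L v)) (hKo : IsOpen (K : Set (Gqs L v))) (hKc : IsCompact (K : Set (Gqs L v))) :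
    Module.finrank ℂ (r.ρ.fixedPoints K) =
      Module.finrank ℂ ((cmPrincipalSeries L 3 v
        (cmTorusCharPair L v (halfModulusChar (LocalRing L v) * halfModulusChar (LocalRing L v))⁻¹ ψ₀)).fixedPoints K) -
      (if (∀ k ∈ K, χdet k = 1) then 1 else 0) := by
  haveI := locallyCompactSpace_cmBorelU L 3 v
  -- length at most two, in house (★ N1 → N2 → N3, as ★ B1 `labelledPair_stChar`)
  have hN1 : U3PrincipalSeriesJacquetFiltration L := F0P3U3PrincipalSeriesJacquetFiltrationHolds.U3PrincipalSeriesJacquetFiltration_holds L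
  have hN2 : U3PrincipalSeriesConstituentEmbeds L := F0P3U3ConstituentEmbedsOfJacquet.u3PrincipalSeriesConstituentEmbeds_of_jacquetFiltration L hN1
  have hN3 : U3PrincipalSeriesLengthLeTwo L := F0P3U3LengthLeTwoOfEmbeds.u3PrincipalSeriesLengthLeTwo_of_embeds L hN1 hN2
  have hc1 := F0P3cStCharTSStChar.continuous_stFst L v
  have hlen := hN3 v hns _ ψ₀ hc1 hψ₀
  have hadm := F0P3XiUnramNonsplitInstance.isAdmissible_cmPrincipalSeries L v
    (cmTorusCharPair L v (halfModulusChar (LocalRing L v) * halfModulusChar (LocalRing L v))⁻¹ ψ₀)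
  haveI : FiniteDimensional ℂ ((cmPrincipalSeries L 3 v
      (cmTorusCharPair L v (halfModulusChar (LocalRing L v) * halfModulusChar (LocalRing L v))⁻¹ ψ₀)).fixedPoints K) := hadm.2 ⟨K, hKo⟩ hKc
  have hsub := IrrClass.finrank_fixedPoints_eq_sub_of_constituents_pair hadm.isSmooth hlen hJH hne hr hπ₁.symm hKc
  rw [← finrank_fixedPoints_ofChar χdet hopen K]
  exact hsub

/-! ## §2 H2 «DET-LEVELS»: a character through `det` is trivial on a level containing the `d(1,b,1)`, `b ∈ E¹_v`, iff it is trivial -/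

/-- **H2.**  Let `detZ : G →* Z(G)` with `detZ g = (det g)·1` and `ι : E¹_v →* Z(G)` with `ι z = z·1` (the ST-PIN clauses, READ) at a non-split `v`.  If `K` contains
every element with matrix `diag(1, b, 1)`, `b ∈ E¹_v`, then `ψ ∘ detZ ≡ 1` on `K` iff `ψ = 1`: `detZ (d(1,b,1)) = ι b` (same matrix `b·1`) and `ι` is ONTO `Z(G)`
(★ ST-JH `surjective_of_pin`). [cite: Rogawski1990, §12.2 (1) p. 173; §4.9 p. 54] -/
theorem comp_detZ_eq_one_on_iff (hns : ∀ w : PlacesOver L v, IsCMField.complexConj L • w.1 = w.1)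
    (ι : ↥(normOneUnits (conjLocal L (IsCMField.complexConj L) v)) →* ↥(Subgroup.center (Gqs L v)))
    (hι : ∀ z : ↥(normOneUnits (conjLocal L (IsCMField.complexConj L) v)),
      ((ι z).val.val.val : Matrix (Fin 3) (Fin 3) (LocalRing L v)) = (((z : (LocalRing L v)ˣ) : LocalRing L v)) • (1 : Matrix (Fin 3) (Fin 3) (LocalRing L v)))
    (detZ : Gqs L v →* ↥(Subgroup.center (Gqs L v)))
    (hdetZ : ∀ g : Gqs L v, ((detZ g).val.val.val : Matrix (Fin 3) (Fin 3) (LocalRing L v)) =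
        (g.val.val : Matrix (Fin 3) (Fin 3) (LocalRing L v)).det • (1 : Matrix (Fin 3) (Fin 3) (LocalRing L v)))
    (K : Subgroup (Gqs L v))
    (hK : ∀ b : ↥(normOneUnits (conjLocal L (IsCMField.complexConj L) v)), ∀ g : Gqs L v,
      (g.val.val : Matrix (Fin 3) (Fin 3) (LocalRing L v)) = Matrix.diagonal ![(1 : LocalRing L v), ((b : (LocalRing L v)ˣ) : LocalRing L v), 1] → g ∈ K)
    (ψ : ↥(Subgroup.center (Gqs L v)) →* ℂˣ) :
    (∀ k ∈ K, ψ (detZ k) = 1) ↔ ψ = 1 := by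
  constructor
  · intro h
    refine MonoidHom.ext fun c => ?_
    obtain ⟨b, rfl⟩ := F0P3cStCharTSStJH.surjective_of_pin L v hns ι hι c
    -- the element `d(1,b,1)`, read on `Gqs L v` (defeq to the literal carrier)
    obtain ⟨t, ht, -⟩ := exists_torus_diag_one_one L v hns b
    let g : Gqs L v := (t : ↥(unitaryGroupOfForm (conjLocal L (IsCMField.complexConj L) v) (cmLocalForm L 3 v)))
    have hgval : g.val = glDiagonal 3 (LocalRing L v) ![(1 : (LocalRing L v)ˣ), (b : (LocalRing L v)ˣ), 1] := ht.symm
    have hgmat : (g.val.val : Matrix (Fin 3) (Fin 3) (LocalRing L v)) =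
        Matrix.diagonal ![(1 : LocalRing L v), ((b : (LocalRing L v)ˣ) : LocalRing L v), 1] := by
      rw [hgval, coe_glDiagonal]
      congr 1
      funext k
      fin_cases k <;> rfl
    have hgK : g ∈ K := hK b g hgmat
    have hdet : detZ g = ι b := by
      apply Subtype.ext; apply Subtype.ext; apply Units.ext
      rw [hdetZ g, hι b, hgmat, Matrix.det_diagonal, Fin.prod_univ_three]
      simp
    rw [MonoidHom.one_apply, ← hdet]
    exact h g hgK
  · intro h k _
    rw [h, MonoidHom.one_apply]

/-! ## §3 H3 at the hyperspecial level `K_v = U(Φ₃)(𝒪_v)`: `dim i_G(χ_St(ψ₀))^{K_v} = [ψ₀ = 1]` -/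

set_option maxHeartbeats 1600000 in
set_option synthInstance.maxHeartbeats 400000 in
-- instance-path unification between `Gqs L v` and the literal carrier of ★ `cmPrincipalSeries`
/-- **H3@`K_v`, the ramified-centre case: `dim i_G(χ_St(ψ₀))^{K_v} = 0` when `ψ₀ b ≠ 1` for some `b ∈ E¹_v`.**  By Iwasawa `G = B·K_v`
(★ `exists_borel_mul_mem_cmLocalIntegralLevel`) the `K_v`-fixed vectors of `i_G(χ)` are the `B ∩ K_v`-fixed vectors of the inducing line (★ one-coset Mackey
`finrank_fixedPoints_smoothIndRep_eq`), and `d(1,b,1) ∈ B ∩ K_v` acts there by `δ_B^{1/2}(d)·χ_St(ψ₀)(d) = ψ₀(b) ≠ 1` (★ `rootDeltaChar_borel_eq_one_of_mem_isCompact`, §0).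
[cite: Rogawski1990, §4.5 p. 45; §12.2 (1) p. 173] [cite: CartierCorvallis1979, §III.3] [cite: Casselman1995, §3] -/
theorem finrank_fixedPoints_cmPrincipalSeries_stChar_integralLevel_eq_zero (hns : ∀ w : PlacesOver L v, IsCMField.complexConj L • w.1 = w.1)
    (ψ₀ : ↥(normOneUnits (conjLocal L (IsCMField.complexConj L) v)) →* ℂˣ)
    {b : ↥(normOneUnits (conjLocal L (IsCMField.complexConj L) v))} (hb : ψ₀ b ≠ 1) :
    Module.finrank ℂ ((cmPrincipalSeries L 3 v
        (cmTorusCharPair L v (halfModulusChar (LocalRing L v) * halfModulusChar (LocalRing L v))⁻¹ ψ₀)).fixedPoints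
          (cmLocalIntegralLevel L 3 (qsForm L) v)) = 0 := by
  haveI := locallyCompactSpace_cmBorelU L 3 v
  have hK := isCompact_isOpen_cmLocalIntegralLevel L 3 (qsForm L) v
  obtain ⟨t, ht, htK⟩ := exists_torus_diag_one_one L v hns b
  -- `d(1,b,1) ∈ B ∩ K_v` acts on the inducing line by `ψ₀(b) ≠ 1`: no `B ∩ K_v`-fixed vector
  have htB : ((t : ↥(unitaryGroupOfForm (conjLocal L (IsCMField.complexConj L) v) (cmLocalForm L 3 v))) ∈ (cmBorelTriple L 3 v).P) :=
    torusU_le_borelU _ _ t.2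
  have hproj : (cmBorelTriple L 3 v).proj ⟨_, htB⟩ = t := by
    apply Subtype.ext
    exact (cmBorelTriple L 3 v).proj_apply_of_mem_M ⟨_, htB⟩ t.2
  have hδ : rootDeltaChar (cmBorelTriple L 3 v).P ⟨_, htB⟩ = 1 :=
    rootDeltaChar_borel_eq_one_of_mem_isCompact _ _ (cmLocalForm_eq_over L 3 v) hK.1 ⟨_, htB⟩ htK
  have hχ : cmTorusCharPair L v (halfModulusChar (LocalRing L v) * halfModulusChar (LocalRing L v))⁻¹ ψ₀ t = ψ₀ b :=
    cmTorusCharPair_diag_one_one L v _ ψ₀ b t ht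
  have hbot : (Representation.twist
      (((Representation.trivial ℂ ↥(torusU (conjLocal L (IsCMField.complexConj L) v) (cmLocalForm L 3 v)) ℂ).twist
        (cmTorusCharPair L v (halfModulusChar (LocalRing L v) * halfModulusChar (LocalRing L v))⁻¹ ψ₀)).comp (cmBorelTriple L 3 v).proj)
      (rootDeltaChar (cmBorelTriple L 3 v).P)).fixedPoints
        ((cmLocalIntegralLevel L 3 (qsForm L) v).subgroupOf (cmBorelTriple L 3 v).P) = ⊥ := by
    refine (Submodule.eq_bot_iff _).2 fun z hz => ?_
    have hp : (⟨_, htB⟩ : ↥(cmBorelTriple L 3 v).P) ∈ (cmLocalIntegralLevel L 3 (qsForm L) v).subgroupOf (cmBorelTriple L 3 v).P :=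
      Subgroup.mem_subgroupOf.2 htK
    have hfix := (Representation.mem_fixedPoints _ _ z).1 hz _ hp
    rw [Representation.twist_apply, hδ, Units.val_one, one_smul, MonoidHom.comp_apply, hproj, Representation.twist_apply,
      Representation.trivial_apply, hχ, smul_eq_mul] at hfix
    -- `ψ₀ b * z = z` with `ψ₀ b ≠ 1`
    have hne : ((ψ₀ b : ℂˣ) : ℂ) ≠ 1 := fun h => hb (Units.val_eq_one.1 h)
    have : (((ψ₀ b : ℂˣ) : ℂ) - 1) * z = 0 := by rw [sub_mul, one_mul, hfix, sub_self]
    rcases mul_eq_zero.1 this with h0 | h0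
    · exact absurd (sub_eq_zero.1 h0) hne
    · exact h0
  -- Iwasawa: the `K_v`-fixed vectors of `i_G(χ)` are the `B ∩ K_v`-fixed vectors of the inducing line (★ one-coset Mackey)
  have hGK : ∀ g : ↥(unitaryGroupOfForm (conjLocal L (IsCMField.complexConj L) v) (cmLocalForm L 3 v)),
      ∃ h : ↥(cmBorelTriple L 3 v).P, ∃ κ : ↥(unitaryGroupOfForm (conjLocal L (IsCMField.complexConj L) v) (cmLocalForm L 3 v)),
        κ ∈ cmLocalIntegralLevel L 3 (qsForm L) v ∧
          g = (h : ↥(unitaryGroupOfForm (conjLocal L (IsCMField.complexConj L) v) (cmLocalForm L 3 v))) * κ := fun g => by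
    obtain ⟨h, κ, hκ, hg⟩ := exists_borel_mul_mem_cmLocalIntegralLevel L 3 v g
    exact ⟨h, κ, hκ, hg⟩
  have hM := Representation.finrank_fixedPoints_smoothIndRep_eq (Representation.twist
      (((Representation.trivial ℂ ↥(torusU (conjLocal L (IsCMField.complexConj L) v) (cmLocalForm L 3 v)) ℂ).twist
        (cmTorusCharPair L v (halfModulusChar (LocalRing L v) * halfModulusChar (LocalRing L v))⁻¹ ψ₀)).comp (cmBorelTriple L 3 v).proj)
      (rootDeltaChar (cmBorelTriple L 3 v).P)) hK.2 hGK
  have hB : Module.finrank ℂ ((Representation.twist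
      (((Representation.trivial ℂ ↥(torusU (conjLocal L (IsCMField.complexConj L) v) (cmLocalForm L 3 v)) ℂ).twist
        (cmTorusCharPair L v (halfModulusChar (LocalRing L v) * halfModulusChar (LocalRing L v))⁻¹ ψ₀)).comp (cmBorelTriple L 3 v).proj)
      (rootDeltaChar (cmBorelTriple L 3 v).P)).fixedPoints
        ((cmLocalIntegralLevel L 3 (qsForm L) v).subgroupOf (cmBorelTriple L 3 v).P)) = 0 := by
    rw [hbot, finrank_bot]
  exact hM.trans hB

open Classical in
set_option maxHeartbeats 1600000 in
set_option synthInstance.maxHeartbeats 400000 in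
-- instance-path unification between `Gqs L v` and the literal carrier of ★ `cmPrincipalSeries`
/-- **H3@`K_v`.**  `dim i_G(χ_St(ψ₀))^{K_v} = 1` if `ψ₀ = 1` — the inducing character `((‖·‖^{1/2}‖·‖^{1/2})⁻¹, 1)` is trivial on `T ∩ K_v` (units of valuation one,
★ `v_torusEntry_eq_one_of_mem_cmLocalIntegralLevel`, ★ `halfModulusChar_eq_one_of_forall_v_eq_one`), so ★ `isSpherical_cmPrincipalSeries` gives the LINE — and `= 0`
otherwise (`finrank_fixedPoints_cmPrincipalSeries_stChar_integralLevel_eq_zero` at a `b` with `ψ₀ b ≠ 1`).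
[cite: Rogawski1990, §4.5 p. 45; §12.2 (1) p. 173] [cite: CartierCorvallis1979, §III.3, §IV.1] [cite: Casselman1995, §3] -/
theorem finrank_fixedPoints_cmPrincipalSeries_stChar_integralLevel (hns : ∀ w : PlacesOver L v, IsCMField.complexConj L • w.1 = w.1)
    (ψ₀ : ↥(normOneUnits (conjLocal L (IsCMField.complexConj L) v)) →* ℂˣ) :
    Module.finrank ℂ ((cmPrincipalSeries L 3 v
        (cmTorusCharPair L v (halfModulusChar (LocalRing L v) * halfModulusChar (LocalRing L v))⁻¹ ψ₀)).fixedPoints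
          (cmLocalIntegralLevel L 3 (qsForm L) v)) = if ψ₀ = 1 then 1 else 0 := by
  haveI := locallyCompactSpace_cmBorelU L 3 v
  by_cases h1 : ψ₀ = 1
  · -- the unramified spherical line
    rw [if_pos h1]
    subst h1
    refine isSpherical_cmPrincipalSeries L 3 v _ fun t ht => ?_
    rw [cmTorusCharPair, torusCharPair_apply, MonoidHom.one_apply, mul_one, MonoidHom.inv_apply, MonoidHom.mul_apply,
      halfModulusChar_eq_one_of_forall_v_eq_one L v _ (v_torusEntry_eq_one_of_mem_cmLocalIntegralLevel L 3 v t ht 0), mul_one, inv_one]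
  · rw [if_neg h1]
    -- a `b ∈ E¹_v` with `ψ₀ b ≠ 1`
    obtain ⟨b, hb⟩ : ∃ b, ψ₀ b ≠ 1 := by
      by_contra hall
      push Not at hall
      exact h1 (MonoidHom.ext fun b => by rw [hall b, MonoidHom.one_apply])
    exact finrank_fixedPoints_cmPrincipalSeries_stChar_integralLevel_eq_zero L v hns ψ₀ hb

end Summit.HodgeConjecture.HodgeConjecture.Cruxes.H413.F0P3cStCharTSStParahoricFixed

end
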